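import Literature.NumberTheory.EllipticCurves.IwasawaAlgebraStructureProofs
import Literature.NumberTheory.EllipticCurves.IwasawaAlgebraPseudoNullProofs
import Literature.NumberTheory.EllipticCurves.IwasawaAlgebraCharIdealProofs
import Literature.NumberTheory.EllipticCurves.IwasawaAlgebraProofs
import Literature.NumberTheory.EllipticCurves.KatoFineSelmerDualMuProofs
import Mathlib.LinearAlgebra.Charpoly.BaseChange
import Mathlib.RingTheory.Polynomial.Basic
import HarnessLib

/-!
# A finitely generated `Λ`-module `X` with `X/pX` finite is finitely generated over `ℤ_p`;
# statement (A) for `Sel₀(K_∞, E[p^∞])` ⟺ `Sel₀(K_∞, E[p^∞])[p]` finite (proved; no named fact)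

`Proofs` file (theorems only); fourth brick of the discharge of
`LimSujatha2018.prop32_fineSelmerDual_moduleFinite_iff_of_torsionIso` (`FineSelmerCongruentCurves`).
Coates–Sujatha's statement (A) — "the Pontryagin dual `Y(E/F^cyc)` of the fine Selmer group is a
finitely generated `ℤ_p`-module" — is read off the `p`-torsion of the fine Selmer group: "`Y` is
finitely generated over `ℤ_p` iff `Y/pY` is finite iff `R(E/F^cyc)[p]` is finite" (Lim–Sujatha 2018 §3,
the sentence before Prop. 3.2; Greenberg LNM 1716 §1 p. 60 and the structure theory of `Λ`-modules,
Washington §13.2).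

* §1–§2 (RE-HOMED from the Summits-side cell files `Rank1Residual/X2/SelmerCotorsionOfFiniteTorsion`
  and `X2/MuVanishingOfFiniteModP` of cell `b2b-bsdres`, whose statements use `ModN X p`; here with the
  `Λ`-submodule `(p)·X`, HONESTLY A DUPLICATE IN SUBSTANCE, needed because Literature cannot import
  Summits): a finitely generated `Λ = ℤ_p⟦T⟧`-module `X` with `X/(p)X` finite is `Λ`-torsion
  (`isTorsion_of_finite_quotient_augIdealP`: `T^k X ⊆ pX`, Cayley–Hamilton) and has `μ(X) = 0`
  (`muInvariant_eq_zero_of_finite_quotient_augIdealP`: structure theorem, a summand `Λ/(p^m)` would make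
  the infinite `Λ/(p)` finite), hence is finitely generated over `ℤ_p`
  (`moduleFinite_padicInt_of_finite_quotient_augIdealP`, tree `muInvariant_eq_zero_iff_holds`).
* §3 for an elliptic curve `W/K`, a `ℤ_p`-extension `κ` with a topological generator:
  `(∃ γ D, D.X finitely generated over ℤ_p) ⟺ Sel₀(K_∞, E[p^∞])[p] finite`
  (`exists_fineSelmerDualData_moduleFinite_iff_finite_pTorsion`): ⟸ by §2 and the tree's
  `finite_quotient_augIdealP_of_finite_pTorsion`; ⟹ by evaluating characters at `ℤ_p`-generators
  (`toDual_C_smul`) and character separation (`CharacterModule.exists_character_apply_ne_zero_of_ne_zero`).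

References: [LimSujatha2018] §3; [GreenbergLNM1716] §1 p. 60–61, Prop. 5.10 (proof);
[GreenbergVatsal2000] Prop. (2.8); [Washington1997] §13.2; [CoatesSujatha2005] §3.
-/

set_option autoImplicit false

noncomputable section

open scoped Classical DirectSum

universe u

namespace Literature.NumberTheory.EllipticCurves.IwasawaModuleFinitePadicInt

open Literature.NumberTheory.EllipticCurves Literature.NumberTheory.EllipticCurves.IwasawaAlgebra
  Polynomial

/-! ## §1 `X` finitely generated with `X/(p)X` finite ⟹ `X` is `Λ`-torsion -/

section Torsion

variable (p : ℕ) [hp : Fact p.Prime]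

/-- `1 - T^n` (`n ≥ 1`) is a unit of `Λ = ℤ_p⟦T⟧` (constant coefficient `1`).
[cite: Washington1997, §13.2 (`Λ` is local with maximal ideal `(p, T)`)] -/
theorem isUnit_one_sub_X_pow {n : ℕ} (hn : n ≠ 0) :
    IsUnit (1 - (PowerSeries.X : IwasawaAlgebra p) ^ n) := by
  rw [PowerSeries.isUnit_iff_constantCoeff, map_sub, map_one, map_pow, PowerSeries.constantCoeff_X,
    zero_pow hn, sub_zero]
  exact isUnit_one

/-- **A FINITE `Λ`-module is killed by a power of `T`.** For each `q`, two of the finitely many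
`T^i • q` coincide, so `(1 − T^{j−i}) • T^i • q = 0` with `1 − T^{j−i}` a unit.
[cite: GreenbergLNM1716, §1 p. 61] -/
theorem exists_pow_X_smul_eq_zero_of_finite (Q : Type u) [AddCommGroup Q]
    [Module (IwasawaAlgebra p) Q] [Finite Q] :
    ∃ k : ℕ, ∀ q : Q, (PowerSeries.X : IwasawaAlgebra p) ^ k • q = 0 := by
  set T : IwasawaAlgebra p := PowerSeries.X with hT
  have hpt : ∀ q : Q, ∃ k : ℕ, T ^ k • q = 0 := by
    intro q
    obtain ⟨i, j, hij, hq⟩ := Finite.exists_ne_map_eq_of_infinite (fun n : ℕ ↦ T ^ n • q)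
    wlog hlt : i < j generalizing i j
    · exact this j i hij.symm hq.symm (lt_of_le_of_ne (not_lt.1 hlt) hij.symm)
    obtain ⟨n, rfl⟩ := Nat.exists_eq_add_of_lt hlt
    refine ⟨i, ?_⟩
    have hq' : (1 - T ^ (n + 1)) • (T ^ i • q) = 0 := by
      rw [sub_smul, one_smul, smul_smul, ← pow_add, add_comm, ← add_assoc, sub_eq_zero]
      exact hq
    have hu := isUnit_one_sub_X_pow p (n := n + 1) (Nat.succ_ne_zero n)
    rw [← hT] at hu
    obtain ⟨u, hu'⟩ := hu
    rw [← hu'] at hq'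
    have h2 := congrArg (fun z ↦ ((u⁻¹ : (IwasawaAlgebra p)ˣ) : IwasawaAlgebra p) • z) hq'
    rw [← mul_smul, Units.inv_mul, one_smul, smul_zero] at h2
    exact h2
  choose k hk using hpt
  haveI : Fintype Q := Fintype.ofFinite Q
  refine ⟨Finset.univ.sup k, fun q ↦ ?_⟩
  obtain ⟨r, hr⟩ := Nat.exists_eq_add_of_le (Finset.le_sup (f := k) (Finset.mem_univ q))
  rw [hr, pow_add, mul_comm, mul_smul, hk, smul_zero]

/-- The reduction `Λ = ℤ_p⟦T⟧ → 𝔽_p⟦T⟧` kills every element of `(p) ⊆ Λ`. [cite: Washington1997, §13.2] -/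
theorem map_toZMod_eq_zero_of_mem_augIdealP {a : IwasawaAlgebra p} (ha : a ∈ augIdealP p) :
    PowerSeries.map (PadicInt.toZMod (p := p)) a = 0 := by
  obtain ⟨t, rfl⟩ := Ideal.mem_span_singleton'.1 ha
  rw [map_mul, PowerSeries.map_C, map_natCast, ZMod.natCast_self, map_zero, mul_zero]

/-- **`X` finitely generated over `Λ` with `X/(p)X` finite ⟹ `X` is a torsion `Λ`-module**:
`T^k X ⊆ pX` (`exists_pow_X_smul_eq_zero_of_finite`); Cayley–Hamilton for the endomorphism `T^k` with
image in `(p)X` gives a monic `q` with lower coefficients in `(p)` and `q(T^k) X = 0`; reducing mod `p`,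
`q(T^k) ≡ T^{k deg q} ≠ 0`. The `p`-adic twin of Greenberg's "if `X/TX` is finite, then `X` is a
torsion `Λ`-module". [cite: GreenbergLNM1716, §1 p. 61 and Prop. 5.10 (proof)] -/
theorem isTorsion_of_finite_quotient_augIdealP (M : Type u) [AddCommGroup M]
    [Module (IwasawaAlgebra p) M] [Module.Finite (IwasawaAlgebra p) M]
    (hfin : Finite (M ⧸ (augIdealP p • (⊤ : Submodule (IwasawaAlgebra p) M)))) :
    Module.IsTorsion (IwasawaAlgebra p) M := by
  have hpr : p.Prime := hp.out
  set P : Submodule (IwasawaAlgebra p) M := augIdealP p • ⊤ with hPdef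
  haveI : Finite (M ⧸ P) := hfin
  -- `T^k M ⊆ pM`
  obtain ⟨k, hk⟩ := exists_pow_X_smul_eq_zero_of_finite p (M ⧸ P)
  have hkM : ∀ x : M, (PowerSeries.X : IwasawaAlgebra p) ^ k • x ∈ P := by
    intro x
    have h1 : P.mkQ ((PowerSeries.X : IwasawaAlgebra p) ^ k • x) = 0 := by rw [map_smul, hk]
    rwa [Submodule.mkQ_apply, Submodule.Quotient.mk_eq_zero] at h1
  -- Cayley–Hamilton for `f = T^k` with `range f ≤ (p) • M`
  set I : Ideal (IwasawaAlgebra p) := augIdealP p with hI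
  set f : Module.End (IwasawaAlgebra p) M :=
    algebraMap (IwasawaAlgebra p) (Module.End (IwasawaAlgebra p) M)
      ((PowerSeries.X : IwasawaAlgebra p) ^ k) with hf
  have hfI : LinearMap.range f ≤ I • ⊤ := by
    rintro _ ⟨x, rfl⟩
    rw [hf, Module.algebraMap_end_apply]
    exact hkM x
  obtain ⟨q, hmonic, -, hcoeff, hq⟩ :=
    LinearMap.exists_monic_and_natDegree_eq_and_coeff_mem_pow_and_aeval_eq_zero
      (IwasawaAlgebra p) f I hfI
  set c : IwasawaAlgebra p := q.eval ((PowerSeries.X : IwasawaAlgebra p) ^ k) with hc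
  have hkill : ∀ x : M, c • x = 0 := fun x ↦ by
    have e := congrArg (fun g : Module.End (IwasawaAlgebra p) M ↦ g x) hq
    simp only [hf, Polynomial.aeval_algebraMap_apply_eq_algebraMap_eval,
      Module.algebraMap_end_apply, LinearMap.zero_apply] at e
    exact e
  have hred : PowerSeries.map (PadicInt.toZMod (p := p)) c =
      (PowerSeries.X : PowerSeries (ZMod p)) ^ (k * q.natDegree) := by
    rw [hc, Polynomial.eval_eq_sum_range, map_sum, Finset.sum_range_succ, Finset.sum_eq_zero]
    · rw [zero_add, map_mul, map_pow, map_pow, PowerSeries.map_X, hmonic.coeff_natDegree, map_one,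
        one_mul, pow_mul]
    · intro i hi
      rw [Finset.mem_range] at hi
      have hmem : q.coeff i ∈ I := Ideal.pow_le_self (Nat.sub_ne_zero_of_lt hi) (hcoeff i)
      rw [map_mul, map_toZMod_eq_zero_of_mem_augIdealP p hmem, zero_mul]
  have hc0 : c ≠ 0 := by
    intro h0
    have h1 := hred
    rw [h0, map_zero] at h1
    exact (pow_ne_zero _ PowerSeries.X_ne_zero) h1.symm
  intro x
  exact ⟨⟨c, mem_nonZeroDivisors_of_ne_zero hc0⟩, hkill x⟩

end Torsion

/-! ## §2 `X/(p)X` finite ⟹ `μ(X) = 0` ⟹ `X` finitely generated over `ℤ_p` -/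

section Mu

variable (p : ℕ) [hp : Fact p.Prime]

/-- **`Λ/(p)` is infinite**: the classes of `T^n` are pairwise distinct. [cite: Washington1997, §13.2] -/
theorem infinite_quotient_augIdealP : Infinite (IwasawaAlgebra p ⧸ augIdealP p) := by
  refine Infinite.of_injective
    (fun n : ℕ ↦ Ideal.Quotient.mk (augIdealP p) ((PowerSeries.X : IwasawaAlgebra p) ^ n))
    fun a b hab ↦ ?_
  by_contra hne
  have hmem : (PowerSeries.X : IwasawaAlgebra p) ^ a - PowerSeries.X ^ b ∈ augIdealP p := by
    rw [← Ideal.Quotient.eq]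
    exact hab
  obtain ⟨c, hc⟩ := Ideal.mem_span_singleton'.mp hmem
  have hcoeff := congrArg (PowerSeries.coeff a) hc
  rw [map_sub, PowerSeries.coeff_X_pow, PowerSeries.coeff_X_pow, if_pos rfl, if_neg hne, sub_zero,
    PowerSeries.coeff_mul_C] at hcoeff
  exact (PadicInt.irreducible_p (p := p)).not_isUnit (IsUnit.of_mul_eq_one_right _ hcoeff)

/-- A module with a finite submodule of finite index is finite. [folklore] -/
private theorem finite_of_finite_submodule_of_finite_quotient {R : Type*} [Ring R] {Q : Type*}
    [AddCommGroup Q] [Module R Q] (N : Submodule R Q) [Finite N] [Finite (Q ⧸ N)] : Finite Q := by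
  apply Nat.finite_of_card_ne_zero
  rw [Submodule.card_eq_card_quotient_mul_card N]
  exact mul_ne_zero Nat.card_pos.ne' Nat.card_pos.ne'

/-- **`X/(p)X` finite ⟹ `μ(X) = 0`** for a finitely generated torsion `Λ`-module (Greenberg–Vatsal
Prop. (2.8), the `μ`-half; Washington §13.2): a summand `Λ/(p^m)`, `m ≥ 1`, of the elementary model
would make the infinite `Λ/(p)` an extension of a quotient of the finite cokernel by an image of the
finite `X/(p)X`. [cite: GreenbergVatsal2000, §2 Prop. (2.8)] [cite: Washington1997, §13.2] -/
theorem muInvariant_eq_zero_of_finite_quotient_augIdealP (M : Type u) [AddCommGroup M]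
    [Module (IwasawaAlgebra p) M] [Module.Finite (IwasawaAlgebra p) M]
    (hM : Module.IsTorsion (IwasawaAlgebra p) M)
    (hfin : Finite (M ⧸ (augIdealP p • (⊤ : Submodule (IwasawaAlgebra p) M)))) :
    muInvariant p M = 0 := by
  obtain ⟨μs, fs, hμpos, hfs, f, hkerf, hcokerf⟩ :=
    exists_isPseudoIsomorphism_elementary_holds p M hM
  rw [muInvariant_eq_sum_holds p M (fun g hg ↦ (hfs g hg).1) ⟨f, hkerf, hcokerf⟩]
  by_contra hsum
  have hlen : 0 < μs.length := by
    rcases μs with _ | ⟨m, tl⟩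
    · exact absurd List.sum_nil hsum
    · exact Nat.succ_pos _
  set i : Fin μs.length := ⟨0, hlen⟩ with hi
  have hm : 0 < μs.get i := hμpos _ (List.get_mem μs i)
  let E₁ := ⨁ k : Fin μs.length,
    IwasawaAlgebra p ⧸ Ideal.span {PowerSeries.C ((p : ℤ_[p]) ^ μs.get k)}
  let E₂ := ⨁ j : Fin fs.length,
    IwasawaAlgebra p ⧸ Ideal.span {((fs.get j).1 : IwasawaAlgebra p) ^ (fs.get j).2}
  let I : Ideal (IwasawaAlgebra p) := Ideal.span {PowerSeries.C ((p : ℤ_[p]) ^ μs.get i)}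
  let J : Ideal (IwasawaAlgebra p) := augIdealP p
  have hIJ : I ≤ J := by
    refine Ideal.span_singleton_le_span_singleton.mpr ⟨PowerSeries.C ((p : ℤ_[p]) ^ (μs.get i - 1)), ?_⟩
    rw [← map_mul, ← pow_succ', Nat.sub_add_cancel hm]
  let π : elementaryModule p μs fs →ₗ[IwasawaAlgebra p] IwasawaAlgebra p ⧸ I :=
    (DirectSum.component (IwasawaAlgebra p) (Fin μs.length)
      (fun k : Fin μs.length ↦
        IwasawaAlgebra p ⧸ Ideal.span {PowerSeries.C ((p : ℤ_[p]) ^ μs.get k)}) i) ∘ₗ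
      LinearMap.fst (IwasawaAlgebra p) E₁ E₂
  let ρ : (IwasawaAlgebra p ⧸ I) →ₗ[IwasawaAlgebra p] IwasawaAlgebra p ⧸ J :=
    Submodule.mapQ I J LinearMap.id (by simpa using hIJ)
  let g : elementaryModule p μs fs →ₗ[IwasawaAlgebra p] IwasawaAlgebra p ⧸ J := ρ ∘ₗ π
  have hπ : Function.Surjective π := by
    intro q
    refine ⟨(show elementaryModule p μs fs from
      (DirectSum.lof (IwasawaAlgebra p) (Fin μs.length)
        (fun k : Fin μs.length ↦
        IwasawaAlgebra p ⧸ Ideal.span {PowerSeries.C ((p : ℤ_[p]) ^ μs.get k)}) i q, (0 : E₂))), ?_⟩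
    change DirectSum.component (IwasawaAlgebra p) (Fin μs.length)
      (fun k : Fin μs.length ↦
        IwasawaAlgebra p ⧸ Ideal.span {PowerSeries.C ((p : ℤ_[p]) ^ μs.get k)}) i
      (DirectSum.lof (IwasawaAlgebra p) (Fin μs.length)
        (fun k : Fin μs.length ↦
        IwasawaAlgebra p ⧸ Ideal.span {PowerSeries.C ((p : ℤ_[p]) ^ μs.get k)}) i q) = q
    exact DirectSum.component.lof_self (IwasawaAlgebra p)
      (M := fun k : Fin μs.length ↦
        IwasawaAlgebra p ⧸ Ideal.span {PowerSeries.C ((p : ℤ_[p]) ^ μs.get k)}) i q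
  have hρ : Function.Surjective ρ := by
    intro q
    obtain ⟨x, rfl⟩ := Submodule.Quotient.mk_surjective J q
    exact ⟨Submodule.Quotient.mk x, rfl⟩
  have hg : Function.Surjective g := hρ.comp hπ
  -- `g ∘ f` kills `(p) • M`
  have hgfJ : augIdealP p • (⊤ : Submodule (IwasawaAlgebra p) M) ≤ LinearMap.ker (g ∘ₗ f) := by
    refine Submodule.smul_le.mpr fun a ha m _ ↦ ?_
    rw [LinearMap.mem_ker, map_smul]
    obtain ⟨y, hy⟩ := Submodule.Quotient.mk_surjective J ((g ∘ₗ f) m)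
    rw [← hy, ← Submodule.Quotient.mk_smul, Submodule.Quotient.mk_eq_zero, smul_eq_mul]
    exact J.mul_mem_right _ ha
  -- `N = g(f(M))` is finite: it is the image of the finite `M/(p)M`
  let N : Submodule (IwasawaAlgebra p) (IwasawaAlgebra p ⧸ J) := LinearMap.range (g ∘ₗ f)
  let h : (M ⧸ (augIdealP p • (⊤ : Submodule (IwasawaAlgebra p) M))) →ₗ[IwasawaAlgebra p]
      IwasawaAlgebra p ⧸ J :=
    Submodule.liftQ (augIdealP p • (⊤ : Submodule (IwasawaAlgebra p) M)) (g ∘ₗ f) hgfJ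
  haveI : Finite (M ⧸ (augIdealP p • (⊤ : Submodule (IwasawaAlgebra p) M))) := hfin
  haveI : Finite N := by
    refine Finite.of_surjective (fun q : M ⧸ (augIdealP p • (⊤ : Submodule (IwasawaAlgebra p) M)) ↦
      (⟨h q, ?_⟩ : N)) ?_
    · obtain ⟨m, rfl⟩ := Submodule.mkQ_surjective _ q
      exact ⟨m, rfl⟩
    · rintro ⟨y, m, rfl⟩
      exact ⟨Submodule.mkQ _ m, rfl⟩
  -- `Λ/(p) / N` is a quotient of the pseudo-null (= finite) `coker f`, hence finite
  haveI : Finite ((IwasawaAlgebra p ⧸ J) ⧸ N) := by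
    let gbar : (elementaryModule p μs fs ⧸ LinearMap.range f) →ₗ[IwasawaAlgebra p]
        (IwasawaAlgebra p ⧸ J) ⧸ N :=
      (LinearMap.range f).mapQ N g (by
        rintro e ⟨m, rfl⟩
        exact ⟨m, rfl⟩)
    have hgbar : Function.Surjective gbar := fun q ↦ by
      obtain ⟨y, rfl⟩ := Submodule.Quotient.mk_surjective N q
      obtain ⟨e, rfl⟩ := hg y
      exact ⟨Submodule.Quotient.mk e, rfl⟩
    exact finite_of_isPseudoNull p _ (Module.IsPseudoNull.of_surjective hcokerf gbar hgbar)
  haveI : Finite (IwasawaAlgebra p ⧸ J) := finite_of_finite_submodule_of_finite_quotient N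
  exact (infinite_quotient_augIdealP p).not_finite ‹_›

/-- **`X` finitely generated over `Λ` with `X/(p)X` finite ⟹ `X` is finitely generated over `ℤ_p`**
(`= RestrictScalars ℤ_[p] Λ X`): torsion (§1) with `μ = 0` (§2), then Washington §13.2
(tree `muInvariant_eq_zero_iff_holds`). Greenberg LNM 1716 §1 p. 60: "`X/𝔪X` finite … Nakayama";
Lim–Sujatha §3: "`Y` is finitely generated over `𝒪` iff `Y/π` is finite".
[cite: Washington1997, §13.2] [cite: LimSujatha2018, §3 (before Prop. 3.2)] -/
theorem moduleFinite_padicInt_of_finite_quotient_augIdealP (M : Type u) [AddCommGroup M]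
    [Module (IwasawaAlgebra p) M] [Module.Finite (IwasawaAlgebra p) M]
    (hfin : Finite (M ⧸ (augIdealP p • (⊤ : Submodule (IwasawaAlgebra p) M)))) :
    Module.Finite ℤ_[p] (RestrictScalars ℤ_[p] (IwasawaAlgebra p) M) := by
  have hT := isTorsion_of_finite_quotient_augIdealP p M hfin
  exact (muInvariant_eq_zero_iff_holds p M hT).mp
    (muInvariant_eq_zero_of_finite_quotient_augIdealP p M hT hfin)

end Mu

/-! ## §3 Statement (A) for `Sel₀(K_∞, E[p^∞])` ⟺ `Sel₀(K_∞, E[p^∞])[p]` finite -/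

section FineSelmer

open NumberField Literature.NumberTheory.GaloisRepresentations WeierstrassCurve

variable {K : Type u} [Field K] [NumberField K] (W : WeierstrassCurve K) {p : ℕ}
  [hp : Fact p.Prime] (κ : ZpExtension K p)

/-- **(A) ⟹ `Sel₀(K_∞, E[p^∞])[p]` finite**: if a dual fine Selmer datum `D` is finitely generated over
`ℤ_p`, with generators `x₁, …, xₙ`, then `s ↦ (xᵢ(s))ᵢ` embeds `Sel₀[p]` into the finite
`(ℚ/ℤ[p])ⁿ` — a character killing `s` on all generators kills it identically (`toDual_C_smul`), and
characters separate points. [cite: LimSujatha2018, §3 (before Prop. 3.2)] [cite: GreenbergLNM1716, §1 p. 60] -/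
theorem finite_pTorsion_of_fineSelmerDualData_moduleFinite {γ : Field.absoluteGaloisGroup K}
    (D : W.FineSelmerDualData κ γ)
    (hD : Module.Finite ℤ_[p] (RestrictScalars ℤ_[p] (IwasawaAlgebra p) D.X)) :
    Set.Finite {s : W.fineSelmerInfty κ | p • s = 0} := by
  obtain ⟨G, hG⟩ := hD
  -- the finite target
  have hT : {u : AddCircle (1 : ℚ) | p • u = 0}.Finite := AddCircle.finite_torsion (1 : ℚ) hp.out.pos
  haveI : Finite {u : AddCircle (1 : ℚ) | p • u = 0} := hT.to_subtype
  -- evaluation at the generators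
  let ev : {s : W.fineSelmerInfty κ | p • s = 0} →
      ({x : RestrictScalars ℤ_[p] (IwasawaAlgebra p) D.X // x ∈ G} → {u : AddCircle (1 : ℚ) | p • u = 0}) :=
    fun s x ↦ ⟨D.toDual (show D.X from (x.1 : RestrictScalars ℤ_[p] (IwasawaAlgebra p) D.X)) s.1, by
      change p • D.toDual _ (s.1 : W.fineSelmerInfty κ) = 0
      rw [← map_nsmul, s.2, map_zero]⟩
  refine Set.finite_coe_iff.mp (Finite.of_injective ev fun s s' hss' ↦ ?_)
  -- a character vanishing on all generators at `s - s'` vanishes identically there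
  have hgen : ∀ x : RestrictScalars ℤ_[p] (IwasawaAlgebra p) D.X,
      D.toDual (show D.X from x) (s.1 : W.fineSelmerInfty κ) =
        D.toDual (show D.X from x) (s'.1 : W.fineSelmerInfty κ) := by
    intro x
    have hx : x ∈ Submodule.span ℤ_[p] (G : Set (RestrictScalars ℤ_[p] (IwasawaAlgebra p) D.X)) := by
      rw [hG]; exact Submodule.mem_top
    refine Submodule.span_induction (M := RestrictScalars ℤ_[p] (IwasawaAlgebra p) D.X)
      (p := fun y _ ↦ D.toDual (show D.X from y) (s.1 : W.fineSelmerInfty κ) =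
        D.toDual (show D.X from y) (s'.1 : W.fineSelmerInfty κ)) ?_ ?_ ?_ ?_ hx
    · intro y hy
      have := congrArg (fun f ↦ ((f ⟨y, Finset.mem_coe.mp hy⟩ : {u : AddCircle (1 : ℚ) | p • u = 0}) :
        AddCircle (1 : ℚ))) hss'
      exact this
    · change D.toDual 0 _ = D.toDual 0 _
      rw [map_zero, AddMonoidHom.zero_apply, AddMonoidHom.zero_apply]
    · intro y z _ _ hy hz
      change D.toDual ((show D.X from y) + (show D.X from z)) _ =
        D.toDual ((show D.X from y) + (show D.X from z)) _
      rw [map_add, AddMonoidHom.add_apply, AddMonoidHom.add_apply, hy, hz]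
    · intro c y _ hy
      have e : c • y = (show RestrictScalars ℤ_[p] (IwasawaAlgebra p) D.X from
          PowerSeries.C c • (show D.X from y)) := by
        rw [RestrictScalars.smul_def, ← PowerSeries.C_eq_algebraMap]; rfl
      rw [e]
      change D.toDual (PowerSeries.C c • (show D.X from y)) _ =
        D.toDual (PowerSeries.C c • (show D.X from y)) _
      have h1 : p ^ 1 • (s.1 : W.fineSelmerInfty κ) = 0 := by rw [pow_one]; exact s.2
      have h2 : p ^ 1 • (s'.1 : W.fineSelmerInfty κ) = 0 := by rw [pow_one]; exact s'.2
      rw [D.toDual_C_smul c _ _ 1 h1, D.toDual_C_smul c _ _ 1 h2, hy]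
  -- characters separate points of `Sel₀`
  apply Subtype.ext
  by_contra hne
  have hne' : (s.1 : W.fineSelmerInfty κ) - s'.1 ≠ 0 := sub_ne_zero.mpr hne
  obtain ⟨χ, hχ⟩ := CharacterModule.exists_character_apply_ne_zero_of_ne_zero hne'
  obtain ⟨x, hx⟩ := D.bijective.2 χ
  apply hχ
  have : χ ((s.1 : W.fineSelmerInfty κ) - s'.1) = 0 := by
    rw [← hx, map_sub]
    exact sub_eq_zero.mpr (hgen x)
  exact this

/-- **Statement (A) for `Sel₀(K_∞, E[p^∞])` ⟺ `Sel₀(K_∞, E[p^∞])[p]` finite** (`W/K` elliptic, `κ` a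
`ℤ_p`-extension with a topological generator `γ₀`): "`Y(E/F_∞)` is finitely generated over `ℤ_p` iff
`Y/pY` is finite iff `R(E/F_∞)[p]` is finite" (Lim–Sujatha §3; Greenberg §1 p. 60). ⟸: the canonical
datum `W.fineSelmerDualData` is finitely generated over `Λ` with `X₀/(p)X₀` finite (tree
`KatoFineSelmerDualMuProofs`), hence finitely generated over `ℤ_p` (§2).
[cite: LimSujatha2018, §3 (before Prop. 3.2)] [cite: GreenbergLNM1716, §1 p. 60] [cite: CoatesSujatha2005, §3 (statement (A))] -/
theorem exists_fineSelmerDualData_moduleFinite_iff_finite_pTorsion {γ₀ : Field.absoluteGaloisGroup K}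
    (hγ₀ : κ.IsTopGenerator γ₀) :
    (∃ (γ : Field.absoluteGaloisGroup K) (D : W.FineSelmerDualData κ γ),
        Module.Finite ℤ_[p] (RestrictScalars ℤ_[p] (IwasawaAlgebra p) D.X)) ↔
      Set.Finite {s : W.fineSelmerInfty κ | p • s = 0} := by
  constructor
  · rintro ⟨γ, D, hD⟩
    exact finite_pTorsion_of_fineSelmerDualData_moduleFinite W κ D hD
  · intro hfin
    let D : W.FineSelmerDualData κ γ₀ := W.fineSelmerDualData κ hγ₀
    haveI : Module.Finite (IwasawaAlgebra p) D.X := D.module_finite_of_finite_pTorsion hγ₀ hfin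
    exact ⟨γ₀, D, moduleFinite_padicInt_of_finite_quotient_augIdealP p D.X
      (D.finite_quotient_augIdealP_of_finite_pTorsion hfin)⟩

end FineSelmer

end Literature.NumberTheory.EllipticCurves.IwasawaModuleFinitePadicInt

end
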